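import Literature.NumberTheory.EllipticCurves.CMTransformationCertificates
import Literature.NumberTheory.EllipticCurves.CMFormalActionTaylorOfTransformationProofs
import Literature.NumberTheory.EllipticCurves.LatticeTransformationIdentity
import HarnessLib

/-!
# The CM transformation pair of `X₀(49)` for `[α₀]`, `α₀ = (1 + √−7)/2`, on the MODEL lattice `(g₂, g₃) = (35/4, 49/8)`,
# recentred at the model `x`-coordinate `x = ℘ + 1/4` with INTEGRAL coefficients (Cox 14.9 / Weber §§114–115 / Silverman AT II.2.3.1 — proofs only)

Topic `NumberTheory/EllipticCurves` (theorems only; no definition, no named fact, no instance, no `sorry`).  Input: the kernel-checked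
certificate `CMCert.check7` (`CMTransformationCertificates`): for `w² = w − 2` and the lattice invariants `(35, −49)`, the polynomials
`P₇ = (−4 − 4w)X² + (12 + 4w)X + (−49 + 35w)`, `Q₇ = 16X + (−32 + 8w)` satisfy the transformation identities (H1), (H2), whence
(`LatticeTransformationIdentity.eval_weierstrassP_eq_weierstrassP_mul_mul`) `P₇(℘ u) = ℘(wu)·Q₇(℘ u)` on any period lattice with these
invariants.  The measure lane of cell `bsd-print-cf2` works with the `K`-model `W = [1, −1, 0, −2, −1]` of `X₀(49)`, whose Néron lattice `Λ₀`
has invariants `(c₄/12, c₆/216) = (35/4, 49/8)` (`X049IntegralModelReadings.cm7Model_c₄_div_twelve / cm7Model_c₆_div`), homothetic to the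
certificate's: `(35, −49) = (λ⁻⁴·35/4, λ⁻⁶·49/8)` for `λ² = −1/2`.  This file proves (brick B8b's inputs `hT`, `hQr`, `hPr`, and p766205's `hQ`,
requested by the (α)-assembler `bsd-line-cf2c-w4` g15 08:34:43Z):

* §1 `toPoly_seven_P`, `toPoly_seven_Q` (the certificate lists as explicit polynomials), `im_ne_zero_of_sq_eq` (`w ∉ ℝ`),
  ★ `isCMCertificate_seven` (`IsCMCertificate 35 (−49) w P₇ Q₇` from `check7` + `check_sound`), degrees;
* §2 ★★ `transformation_seven_model` — **on a lattice `Λ₀` with `(g₂, g₃) = (35/4, 49/8)`: `P_Λ(℘ z) = ℘(wz)·Q_Λ(℘ z)` for `z, wz ∉ Λ₀`**, with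
  `P_Λ = (−16 − 16w)X² + (−24 − 8w)X + (−49 + 35w)`, `Q_Λ = 64X + (64 − 16w)` (`= P₇(−2X), −2Q₇(−2X)`: `PeriodPair.transformation_of_mulLeft`);
* §3 ★★ `recenter_seven_Q`, `recenter_seven_P` — **the recentred pair at the model shift `b = b₂/12 = −1/4` with the scalar `s = 1/16` is INTEGRAL**:
  `(1/16)·Q_Λ(X − 1/4) = 4X + (3 − w)`, `(1/16)·(P_Λ(X − 1/4) − (−1/4)·Q_Λ(X − 1/4)) = (−1 − w)X² + (2w − 2)` — the `hQr`/`hPr` right-hand sides of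
  `CMFormalActionReadingIdentities.cmX_identity_of_reading` with `s := 1/16`; so over ANY data ring `R` with a lift `a` of `w`,
  `Qr := C 4 * X + C (3 − a)`, `Pr := C (−1 − a) * X ^ 2 + C (2a − 2)` are the lifts (`map_seven_Qr`, `map_seven_Pr`);
* §4 ★ `eval_seven_Phat_ne_zero_of_eval_Qhat_eq_zero` (`Q̂(x) = 0 ⇒ P̂(x) = 7(5w − 7)/16 ≠ 0`) and ★★ `eval_seven_Qhat_ne_zero`:
  **for `z, wz ∉ Λ₀`, `Q̂(℘ z − b₂/12… ) ≠ 0`** stated as `(C 4 * X + C (3 − w)).eval (℘ z + 1/4) ≠ 0` — p766205's hypothesis `hQ` at `b := 0`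
  (`X₀ + 0 = x(ξ z) = ℘ z − b₂/12 = ℘ z + 1/4`).

Cell `bsd-print-cf2`, width seat `bsd-line-cf2-p1-w7` g15 (piece (PQ7)); nothing here closes a crux; no summit statement is proved; BSD is not
proved by any of this.

## References
* [Cox2013] D. A. Cox, *Primes of the form x² + ny²*, 2nd ed. (2013), Prop. 14.9, §14.B.
* [SilvermanATAEC1994] J. H. Silverman, *Advanced Topics in the Arithmetic of Elliptic Curves* (1994), Prop. II.2.3.1 (iii) (`[α](x,y)` for `D = −7`).
* [SilvermanAEC2009] J. H. Silverman, *The Arithmetic of Elliptic Curves*, 2nd ed. (2009), III §1 (`x = ℘ − b₂/12`), VI.3.6.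
-/

noncomputable section

open Polynomial
open scoped PeriodPair

namespace Literature.NumberTheory.EllipticCurves

open CMCert _root_.PeriodPair

/-! ## §1. The certificate `check7` as explicit complex polynomials -/

section Cert

variable {w : ℂ} (hw : w ^ 2 = w - 2)

/-- `P₇ = (−49 + 35w) + (12 + 4w)X + (−4 − 4w)X²` as the value of the certificate list. [cite: Cox2013, Prop. 14.9] -/
theorem toPoly_seven_P (w : ℂ) :
    CMCert.Poly.toPoly w [⟨-49, 35⟩, ⟨12, 4⟩, ⟨-4, -4⟩] = C (-4 - 4 * w) * X ^ 2 + C (12 + 4 * w) * X + C (-49 + 35 * w) := by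
  simp only [CMCert.Poly.toPoly_cons, CMCert.Poly.toPoly_nil, CMCert.ZW.toC_mk, map_add, map_neg, map_mul, map_sub, map_intCast,
    map_ofNat]
  push_cast
  ring

/-- `Q₇ = (−32 + 8w) + 16X`. [cite: Cox2013, Prop. 14.9] -/
theorem toPoly_seven_Q (w : ℂ) : CMCert.Poly.toPoly w [⟨-32, 8⟩, ⟨16, 0⟩] = C 16 * X + C (-32 + 8 * w) := by
  simp only [CMCert.Poly.toPoly_cons, CMCert.Poly.toPoly_nil, CMCert.ZW.toC_mk, map_add, map_neg, map_mul, map_intCast, map_ofNat]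
  push_cast
  ring

include hw in
/-- A root of `X² − X + 2` is not real (discriminant `−7`). [cite: Cox2013, §7.A (d_K = −7)] -/
theorem im_ne_zero_of_sq_eq : w.im ≠ 0 := by
  intro him
  have h2 : w.re * w.re - w.im * w.im = w.re - 2 := by
    have := congrArg Complex.re hw
    simpa [sq, Complex.mul_re] using this
  rw [him, mul_zero, sub_zero] at h2
  nlinarith [sq_nonneg (w.re - 1/2)]

include hw in
/-- `w ≠ 0`. [cite: Cox2013, §7.A] -/
theorem ne_zero_of_sq_eq : w ≠ 0 := by
  intro h0; rw [h0] at hw; norm_num at hw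

include hw in
/-- `−4 − 4w ≠ 0` (else `w = −1`, but `(−1)² ≠ −1 − 2`). [cite: Cox2013, §7.A] -/
theorem lead_seven_P_ne_zero : (-4 - 4 * w : ℂ) ≠ 0 := by
  intro h
  have : w = -1 := by linear_combination (-1/4 : ℂ) * h
  rw [this] at hw; norm_num at hw

include hw in
/-- ★ **The certificate for `d = −7` read in `ℂ`**: `IsCMCertificate 35 (−49) w P₇ Q₇`. [cite: Cox2013, Prop. 14.9] [cite: SilvermanATAEC1994, Prop. II.2.3.1] -/
theorem isCMCertificate_seven :
    CMCert.IsCMCertificate (35 : ℂ) (-49) w (C (-4 - 4 * w) * X ^ 2 + C (12 + 4 * w) * X + C (-49 + 35 * w))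
      (C 16 * X + C (-32 + 8 * w)) := by
  have h := CMCert.check_sound (t := 1) (n := 2) (A := 35) (B := -49) (α := ⟨0, 1⟩) (w := w)
    (by rw [hw]; push_cast; ring) (im_ne_zero_of_sq_eq hw) CMCert.check7
  rw [toPoly_seven_P, toPoly_seven_Q, CMCert.ZW.toC_mk] at h
  simpa using h

/-- `deg Q₇ = 1 < 2 = deg P₇`. [cite: Cox2013, Prop. 14.9] -/
theorem natDegree_seven_Q_lt (hw : w ^ 2 = w - 2) :
    (C 16 * X + C (-32 + 8 * w) : ℂ[X]).natDegree < (C (-4 - 4 * w) * X ^ 2 + C (12 + 4 * w) * X + C (-49 + 35 * w)).natDegree := by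
  rw [Polynomial.natDegree_linear (by norm_num), Polynomial.natDegree_quadratic (lead_seven_P_ne_zero hw)]
  norm_num

end Cert

/-! ## §2. Transport to the model lattice `(35/4, 49/8)` -/

section Model

variable {w : ℂ} (hw : w ^ 2 = w - 2) (L : PeriodPair) (h₂ : L.g₂ = 35 / 4) (h₃ : L.g₃ = 49 / 8)

include hw h₂ h₃ in
/-- ★★ **The transformation pair of `[w]` on the model lattice**: for `Λ₀` with `(g₂, g₃) = (35/4, 49/8)` and `z, wz ∉ Λ₀`,
`P_Λ(℘ z) = ℘(wz)·Q_Λ(℘ z)` with `P_Λ = (−16 − 16w)X² + (−24 − 8w)X + (−49 + 35w)`, `Q_Λ = 64X + (64 − 16w)`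
(the certificate pair transported along the homothety `λΛ₀`, `λ² = −1/2`, whose invariants are `(35, −49)`).
[cite: Cox2013, Prop. 14.9, Thm. 10.14] [cite: SilvermanAEC2009, VI.3.6] -/
theorem transformation_seven_model :
    ∀ z : ℂ, z ∉ L.lattice → w * z ∉ L.lattice →
      (C (-16 - 16 * w) * X ^ 2 + C (-24 - 8 * w) * X + C (-49 + 35 * w) : ℂ[X]).eval (℘[L] z) =
        ℘[L] (w * z) * (C 64 * X + C (64 - 16 * w) : ℂ[X]).eval (℘[L] z) := by
  -- a square root `c` of `−1/2`
  obtain ⟨c, hc⟩ := IsAlgClosed.exists_pow_nat_eq (-1 / 2 : ℂ) (by norm_num : 0 < 2)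
  have hc0 : c ≠ 0 := by intro h; rw [h] at hc; norm_num at hc
  have hc4 : (c ^ 4)⁻¹ = 4 := by rw [show c ^ 4 = (c ^ 2) ^ 2 by ring, hc]; norm_num
  have hc6 : (c ^ 6)⁻¹ = -8 := by rw [show c ^ 6 = (c ^ 2) ^ 3 by ring, hc]; norm_num
  have hc2 : (c ^ 2)⁻¹ = -2 := by rw [hc]; norm_num
  -- the homothetic lattice has the certificate's invariants
  have hg₂ : (L.mulLeft c hc0).g₂ = (35 : ℂ) := by rw [g₂_mulLeft, hc4, h₂]; norm_num
  have hg₃ : (L.mulLeft c hc0).g₃ = (-49 : ℂ) := by rw [g₃_mulLeft, hc6, h₃]; norm_num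
  obtain ⟨hQ0, h1, h2⟩ := isCMCertificate_seven hw
  have hT' : ∀ u : ℂ, u ∉ (L.mulLeft c hc0).lattice → w * u ∉ (L.mulLeft c hc0).lattice →
      (C (-4 - 4 * w) * X ^ 2 + C (12 + 4 * w) * X + C (-49 + 35 * w) : ℂ[X]).eval (℘[L.mulLeft c hc0] u) =
        ℘[L.mulLeft c hc0] (w * u) * (C 16 * X + C (-32 + 8 * w) : ℂ[X]).eval (℘[L.mulLeft c hc0] u) := by
    intro u hu hwu
    refine eval_weierstrassP_eq_weierstrassP_mul_mul (L := L.mulLeft c hc0) (ne_zero_of_sq_eq hw) hQ0 (natDegree_seven_Q_lt hw) ?_ ?_ hu hwu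
    · rw [hg₂, hg₃]; simpa using h1
    · rw [hg₂, hg₃]; simpa using h2
  have h := transformation_of_mulLeft L hc0 hT'
  intro z hz hwz
  have hz' := h z hz hwz
  rw [hc2] at hz'
  -- identify the transported polynomials with the displayed ones
  have eP : ((C (-4 - 4 * w) * X ^ 2 + C (12 + 4 * w) * X + C (-49 + 35 * w) : ℂ[X]).comp (C (-2) * X)) =
      C (-16 - 16 * w) * X ^ 2 + C (-24 - 8 * w) * X + C (-49 + 35 * w) := by
    simp only [add_comp, mul_comp, C_comp, pow_comp, X_comp]
    simp only [map_neg, map_sub, map_mul, map_add, map_ofNat]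
    ring
  have eQ : (C (-2) * (C 16 * X + C (-32 + 8 * w) : ℂ[X]).comp (C (-2) * X)) = C 64 * X + C (64 - 16 * w) := by
    simp only [add_comp, mul_comp, C_comp, X_comp]
    simp only [map_neg, map_sub, map_mul, map_add, map_ofNat]
    ring
  rw [eP, eQ] at hz'
  exact hz'

end Model

/-! ## §3. Recentring at `b = b₂/12 = −1/4` with `s = 1/16`: integral coefficients -/

section Recenter

variable (w : ℂ)

/-- ★★ **`(1/16)·Q_Λ(X − 1/4) = 4X + (3 − w)`** — the `hQr` right-hand side of `cmX_identity_of_reading` (`s = 1/16`, `b₂/12 = −1/4`).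
[cite: SilvermanAEC2009, III §1] -/
theorem recenter_seven_Q :
    C (1 / 16 : ℂ) * (C 64 * X + C (64 - 16 * w) : ℂ[X]).comp (X + C (-1 / 4 : ℂ)) = C 4 * X + C (3 - w) := by
  refine Polynomial.funext fun x ↦ ?_
  simp only [eval_mul, eval_C, eval_add, eval_comp, eval_X]
  ring

/-- ★★ **`(1/16)·(P_Λ(X − 1/4) − (−1/4)·Q_Λ(X − 1/4)) = (−1 − w)X² + (2w − 2)`** (using `w² = w − 2`) — the `hPr` right-hand side of
`cmX_identity_of_reading`; INTEGRAL over `ℤ[w]` (a plain polynomial identity). [cite: SilvermanAEC2009, III §1] [cite: Cox2013, Prop. 14.9] -/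
theorem recenter_seven_P :
    C (1 / 16 : ℂ) * ((C (-16 - 16 * w) * X ^ 2 + C (-24 - 8 * w) * X + C (-49 + 35 * w) : ℂ[X]).comp (X + C (-1 / 4 : ℂ)) -
        C (-1 / 4 : ℂ) * (C 64 * X + C (64 - 16 * w) : ℂ[X]).comp (X + C (-1 / 4 : ℂ))) =
      C (-1 - w) * X ^ 2 + C (2 * w - 2) := by
  refine Polynomial.funext fun x ↦ ?_
  simp only [eval_mul, eval_C, eval_add, eval_sub, eval_comp, eval_X, eval_pow]
  ring

/-- The lifts over a data ring: for any ring map `φ : R → ℂ` and `a ∈ R` with `φ a = w`, `(C 4 * X + C (3 − a)).map φ = 4X + (3 − w)`.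
[cite: SilvermanAEC2009, III §1] -/
theorem map_seven_Qr {R : Type*} [CommRing R] (φ : R →+* ℂ) {a : R} (ha : φ a = w) :
    (C 4 * X + C (3 - a) : R[X]).map φ = C 4 * X + C (3 - w) := by
  simp [Polynomial.map_add, Polynomial.map_mul, ha, map_ofNat]

/-- The lifts over a data ring: `(C (−1 − a) * X² + C (2a − 2)).map φ = (−1 − w)X² + (2w − 2)`. [cite: SilvermanAEC2009, III §1] -/
theorem map_seven_Pr {R : Type*} [CommRing R] (φ : R →+* ℂ) {a : R} (ha : φ a = w) :
    (C (-1 - a) * X ^ 2 + C (2 * a - 2) : R[X]).map φ = C (-1 - w) * X ^ 2 + C (2 * w - 2) := by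
  simp [Polynomial.map_add, Polynomial.map_mul, ha, map_ofNat]

end Recenter

/-! ## §4. Non-vanishing of `Q̂` at the points of the formal group -/

section Nonvanishing

variable {w : ℂ} (hw : w ^ 2 = w - 2)

include hw in
/-- ★ `Q̂(x) = 0 ⇒ P̂(x) ≠ 0`: the recentred pair has no common zero (`P̂((w − 3)/4) = 7(5w − 7)/16 ≠ 0`, `w ∉ ℚ`).
[cite: Cox2013, Prop. 14.9] -/
theorem eval_seven_Phat_ne_zero_of_eval_Qhat_eq_zero {x : ℂ} (hx : (C 4 * X + C (3 - w) : ℂ[X]).eval x = 0) :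
    (C (-1 - w) * X ^ 2 + C (2 * w - 2) : ℂ[X]).eval x ≠ 0 := by
  simp only [eval_add, eval_mul, eval_C, eval_X, eval_pow] at hx ⊢
  have hx' : x = (w - 3) / 4 := by linear_combination (1/4 : ℂ) * hx
  rw [hx']
  intro h
  have key : (35 : ℂ) * w - 49 = 0 := by linear_combination (16 : ℂ) * h + (w - 4) * hw
  have hw' : w = 49 / 35 := by linear_combination (1/35 : ℂ) * key
  have him := im_ne_zero_of_sq_eq hw
  rw [hw'] at him
  norm_num at him

/-- `Q_Λ(x) = 16·Q̂(x − b₂/12)`: `Q_Λ(℘) = 0 ↔ Q̂(℘ + 1/4) = 0` (bookkeeping between the two presentations). [cite: SilvermanAEC2009, III §1] -/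
theorem eval_seven_QΛ_eq (y : ℂ) :
    (C 64 * X + C (64 - 16 * w) : ℂ[X]).eval y = 16 * (C 4 * X + C (3 - w) : ℂ[X]).eval (y + 1 / 4) := by
  simp only [eval_add, eval_mul, eval_C, eval_X]
  ring

include hw in
/-- ★★ **`Q̂` does not vanish at `x(ξ z) = ℘ z + 1/4` when `z, wz ∉ Λ₀`** (`Λ₀` the model lattice): if it did, `Q_Λ(℘ z) = 0`, so
`P_Λ(℘ z) = ℘(wz)·Q_Λ(℘ z) = 0`, so `P̂(℘ z + 1/4) = 0` — contradicting §4's coprimality.  This is the hypothesis `hQ` of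
`CMFormalActionNilIdealPointsChart.some_add_ptOfZ_evalPt₁_eq_of_cm_identities` (with `b := 0`) for the lifted pair.
[cite: Cox2013, Prop. 14.9] [cite: SilvermanATAEC1994, Prop. II.2.3.1] -/
theorem eval_seven_Qhat_ne_zero (L : PeriodPair) (h₂ : L.g₂ = 35 / 4) (h₃ : L.g₃ = 49 / 8) {z : ℂ} (hz : z ∉ L.lattice)
    (hwz : w * z ∉ L.lattice) : (C 4 * X + C (3 - w) : ℂ[X]).eval (℘[L] z + 1 / 4) ≠ 0 := by
  intro h0
  have hT := transformation_seven_model hw L h₂ h₃ z hz hwz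
  rw [eval_seven_QΛ_eq, h0, mul_zero, mul_zero] at hT
  -- `P_Λ(℘ z) = 16·P̂(℘ z + 1/4) + (−1/4)... `: recentre P as well
  have hP : (C (-16 - 16 * w) * X ^ 2 + C (-24 - 8 * w) * X + C (-49 + 35 * w) : ℂ[X]).eval (℘[L] z) =
      16 * (C (-1 - w) * X ^ 2 + C (2 * w - 2) : ℂ[X]).eval (℘[L] z + 1 / 4) -
        4 * (C 4 * X + C (3 - w) : ℂ[X]).eval (℘[L] z + 1 / 4) := by
    simp only [eval_add, eval_mul, eval_C, eval_X, eval_pow]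
    ring
  rw [hP, h0, mul_zero, sub_zero] at hT
  have h16 : (C (-1 - w) * X ^ 2 + C (2 * w - 2) : ℂ[X]).eval (℘[L] z + 1 / 4) = 0 := by
    have := hT; linear_combination (1/16 : ℂ) * this
  exact eval_seven_Phat_ne_zero_of_eval_Qhat_eq_zero hw h0 h16

end Nonvanishing

end Literature.NumberTheory.EllipticCurves

end
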